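import Summits.Ventures.QEC.Census.CertCheck
import HarnessLib

/-!
# Distance certificate DATA for the census row `2bga-g30-A0.1.3.10-B0.1.9.28` (family GB) as `TB_g30_A0_1_3_10_B0_1_9_28.cert` — emitted by qec-type-07 (07.MITMK)

Source certificate: `cert/search-8/j264005/2bga-g30-A0.1.3.10-B0.1.9.28.certA.json` — kernel A, id (sha256) `0e028772e3faedaa7a8c8d33504606e9272c7fc3034d36ceaa5d97669329ce5f` (`certA=0e028772e3faedaa`),
lower-bound methods bz (Z) / bz (X) as RUN BY KERNEL A; here only its matrices,
upper witnesses and allow-lists are data — the lower bound is RE-ESTABLISHED in the kernel by the meet-in-the-middle lane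
`Census/CertMitmK.lean` (sibling files `MitmKZ*.lean` — Z side; the X side by the kernel X↔Z swap of `Census/CertCheckXZSwap.lean`), the row theorem is `GB/TB_g30_A0_1_3_10_B0_1_9_28/Distance.lean`.
Code: n = 60, 30 X-checks, 30 Z-checks; construction {"type": "explicit"}; generators
`/work/gens/q/2bga-g30-A0.1.3.10-B0.1.9.28.json` (matrix_sha256 `3774e512be5d53d4486b29d60a695353af7a75d6f5f32d6b960d1873dbd9a60b`); claimed (n, k, dZ, dX) =
(60, 8, 8, 8) — a CLAIM of the certificate until the sibling theorems;
printed/third-party value: none — a census-discovered code (no parameters for it are claimed in print; any TABLE `d_printed` entry is a census/third-method comparator, wording qec-lead's).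
Allow-lists (`found`): side Z: the certificate's 0 words verbatim; side X: the certificate's list verbatim (not used: the X side follows by the kernel X↔Z swap, `Distance.lean`).
Format = qec-search-7's `emit_lean.py` (`Census/<F>/<Code>/Cert.lean` convention: supports as binary numerals, bit `j` =
qubit `j` of the gens file, identity layout). This file is DATA: no theorem, no `decide`. Generated 2026-08-27T20:24Z by
HOME/census/type-07/emit_mitmk.py; do not edit by hand — re-emit.
-/

namespace Summit.Ventures.QEC.Census.TB_g30_A0_1_3_10_B0_1_9_28

/-- The distance certificate of `TB_g30_A0_1_3_10_B0_1_9_28` as a `DistCert` literal (CERT-FORMAT v1 kernel fields; certificate id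
`0e028772e3faedaa`): `n = 60`, `HX`/`HZ` = the 30 + 30 check rows (words as binary numerals (bit `j` = qubit `j`)), side Z =
(d := 8, weight-8 Z-logical witness, its non-membership witness, allow-list of 0 stabilizer words with
their row decompositions), side X likewise (d := 8, 0 words). -/
def cert : DistCert where
  n := 60
  HX := [
    288230929128752139, 576461858257504278, 2212981903404, 4425963806808, 8851927613616, 17703855227232,
    35407710454464, 70815420908928, 141630841817856, 283261683635712, 566523367271424, 1133046734542848,
    2266093469085696, 4532186938171392, 9064373876342784, 18128747752685568, 36257495505371136, 72514991010742272,
    145029982021484544, 290059964042969088, 580119927012196353, 7318350491287554, 14636700982575108, 29273401965150216,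
    58546803930300432, 117093607860600864, 234187215721201728, 468374430368661633, 936748860737323266, 720576216867799557]
  HZ := [
    721701841898831877, 290482179190816779, 580964358381633558, 9007213230161964, 18014426460323928, 36028852920647856,
    72057705841295712, 144115411682591424, 288230823365182848, 576461645656623873, 1787780142594, 3575560285188,
    7151120570376, 14302241140752, 28604482281504, 57208964563008, 114417929126016, 228835858252032,
    457671716504064, 915343433008128, 1830686866016256, 3661373732032512, 7322747464065024, 14645494928130048,
    29290989856260096, 58581979712520192, 117163959425040384, 234327918850080768, 468655836626419713, 937311673252839426]
  sideZ := { d := 8, witness := 9012718287718916, nonmember := 243765181737,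
             found := [] }
  sideX := { d := 8, witness := 720576009434333264, nonmember := 596523235,
             found := [] }

end Summit.Ventures.QEC.Census.TB_g30_A0_1_3_10_B0_1_9_28
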